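import Summits.AtomisticToContinuum.BoseEinsteinCondensation.Theorems.BECGroundStateSOSBoundaryTransferWeakHardWallLimitAux
import Summits.AtomisticToContinuum.BoseEinsteinCondensation.Theorems.BECGroundStateSOSBoundaryTransferWeakHardWallLimitCutoffState
import Summits.AtomisticToContinuum.BoseEinsteinCondensation.Theorems.BECGroundStateSOSBoundaryTransferWeakHardWallLimitShrink

/-!
# Route `BECGroundStateSOS`, crux `BoundaryTransferWeak` (stmt-AtomisticToContinuum-0827),
# line `rim-squeeze-monotone-coherence`, stub (L): the near-minimiser transfer chain at fixed parameters

Supports (does not close) stmt-AtomisticToContinuum-0827; auxiliary block of the registered stub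
`stub_hardWallLimit` (L) (lead c3). This file COMPOSES the three analytic blocks of the transfer
across the hard wall — rim-layer cut-off (`…CutoffState`), `2h`-translation modulus
(`…Modulus`) and shrink of the fattened cube (`…Shrink`) — at FIXED parameters: for a bounded
finite-range pair potential `v ≤ M`, side `L` with `L/2 + R₀ ≤ L`, cut-off width `h`
(`8h < L`), Young parameter `η`, slack `δr ≤ 1` and a rim-mass ceiling `μr ≤ 1/2` enforced by
`t ≥ T₀`, `K ≤ μr T₀` (`K ≥ E₀^D(N, L/2) + 1`), every `δr`-near-minimiser `Ψ` of `H_t` yields a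
Dirichlet trial state `Φ` of the cube of side `L/2` with

`energy v Φ ≤ E₀^D + ofReal ((σ²p₁ - 1)K + σ²p₁δr + σ²q₁ + 2N²M √b₃)`,
`∫ |Φ - 1_cell Ψ|² ≤ ofReal ((√b₃ + √(4μr) + √b₂)²)`,

where `σ = 1 + 8h/L` (the inverse shrink factor), `D = 2c₀/h`, `a₁ = 1 + 2μr ≥ (1-μr)⁻¹`,
`p₁ = a₁(1+η)`, `q₁ = a₁(1+η⁻¹)D²·3μr`, `k₁ = p₁K + q₁`, `b₃ = 6N(σ-1) + 18N(σ-1)²(L/2+4h)²k₁`,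
`b₂ = 36N h² K`, and `s⁻²` reads `σ²` (`transfer_chain`, anchor `stub_hardWallLimit_chain`). All error terms tend to `0` as `h → 0` and then `μr → 0`; that limit
bookkeeping, and the resulting proof of (L) for bounded `v`, is the sequel `…HardWallLimitBounded.lean`.
All `[folklore]`.
-/

noncomputable section

namespace Summit.AtomisticToContinuum.BoseEinsteinCondensation.RimSqueeze

open Literature.MathematicalPhysics.QuantumManyBody.BoseGas
open MeasureTheory Filter Set
open scoped ENNReal NNReal ComplexConjugate

variable {N : ℕ} {L : ℝ}

/-- The all-particle shift by `-2h` along every axis has configuration norm `‖U‖² ≤ 12h²`.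
[folklore] -/
theorem norm_shift_sq_le (N : ℕ) (h : ℝ) :
    ‖(fun _ : Fin N => (WithLp.toLp 2 fun _ : Fin 3 => -(2 * h) : Space))‖ ^ 2 ≤ 12 * h ^ 2 := by
  have hu : ‖(WithLp.toLp 2 fun _ : Fin 3 => -(2 * h) : Space)‖ ^ 2 = 12 * h ^ 2 := by
    rw [EuclideanSpace.norm_eq, Real.sq_sqrt (Finset.sum_nonneg fun _ _ => sq_nonneg _)]
    simp only [Real.norm_eq_abs, sq_abs, Finset.sum_const, Finset.card_univ,
      Fintype.card_fin, nsmul_eq_mul]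
    push_cast
    ring
  rw [← hu]
  exact pow_le_pow_left₀ (norm_nonneg _) (pi_norm_const_le _) 2

/-- The rim mass of a `δ`-near-minimiser of `H_t` with `t ≥ T₀` is at most `K/T₀` once
`E_t + δ ≤ K` (and it vanishes at `t = ⊤`). [folklore] -/
theorem rimMass_le_ofReal {v : ℝ → ℝ≥0∞} {t : ℝ≥0∞} {K T₀ δr : ℝ} (hT₀ : 0 < T₀)
    (ht : ENNReal.ofReal T₀ ≤ t) (Ψ : PeriodicTrialState N L)
    (hΨ : rampEnergy v (rimPot L) t Ψ ≤ rampGroundStateEnergy v (rimPot L) t N L + ENNReal.ofReal δr)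
    (hK : rampGroundStateEnergy v (rimPot L) t N L + ENNReal.ofReal δr ≤ ENNReal.ofReal K) :
    ∫⁻ X in cellN N L, (∑ j, rimPot L (X j)) * (‖Ψ.ψ X‖₊ : ℝ≥0∞) ^ 2 ≤ ENNReal.ofReal (K / T₀) := by
  have ht0 : t ≠ 0 := (lt_of_lt_of_le (ENNReal.ofReal_pos.2 hT₀) ht).ne'
  rcases eq_or_ne t ⊤ with rfl | htop
  · -- at `t = ⊤` the rim mass vanishes
    by_contra hm
    have hm' : ∫⁻ X in cellN N L, (∑ j, rimPot L (X j)) * (‖Ψ.ψ X‖₊ : ℝ≥0∞) ^ 2 ≠ 0 :=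
      fun h0 => hm (h0 ▸ zero_le)
    have htop' : rampEnergy v (rimPot L) ⊤ Ψ = ⊤ := by
      rw [rampEnergy, rimEnergy, ENNReal.top_mul hm', add_top]
    rw [htop'] at hΨ
    exact ENNReal.ofReal_ne_top (top_le_iff.1 (hΨ.trans hK))
  · calc _ ≤ (rampGroundStateEnergy v (rimPot L) t N L + ENNReal.ofReal δr) / t :=
          rimMass_le_of_rampEnergy_le ht0 htop Ψ hΨ
      _ ≤ ENNReal.ofReal K / ENNReal.ofReal T₀ := ENNReal.div_le_div hK ht
      _ = ENNReal.ofReal (K / T₀) := (ENNReal.ofReal_div_of_pos hT₀).symm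

/-- `ofReal` of a natural number. [folklore] -/
theorem natCast_eq_ofReal (n : ℕ) : (n : ℝ≥0∞) = ENNReal.ofReal n := (ENNReal.ofReal_natCast n).symm

/-- Real bookkeeping of the energy bound: with `E ≤ K`, `1 ≤ σp`,
`σp (E + δ) + σq + c ≤ E + ((σp - 1)K + σp δ + σq + c)`. [folklore] -/
theorem ofReal_mul_add_le_add_ofReal {E : ℝ≥0∞} {K σp δr σq c : ℝ} (hEK : E ≤ ENNReal.ofReal K)
    (hK : 0 ≤ K) (h1 : 1 ≤ σp) (hδ : 0 ≤ δr) (hq : 0 ≤ σq) (hc : 0 ≤ c) :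
    ENNReal.ofReal σp * (E + ENNReal.ofReal δr) + ENNReal.ofReal σq + ENNReal.ofReal c ≤
      E + ENNReal.ofReal ((σp - 1) * K + σp * δr + σq + c) := by
  have e1 : ENNReal.ofReal σp = 1 + ENNReal.ofReal (σp - 1) := by
    rw [← ENNReal.ofReal_one, ← ENNReal.ofReal_add zero_le_one (by linarith)]
    congr 1
    ring
  rw [e1]
  calc (1 + ENNReal.ofReal (σp - 1)) * (E + ENNReal.ofReal δr) + ENNReal.ofReal σq + ENNReal.ofReal c
      = E + (ENNReal.ofReal (σp - 1) * E + (ENNReal.ofReal δr + ENNReal.ofReal (σp - 1) *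
          ENNReal.ofReal δr + ENNReal.ofReal σq + ENNReal.ofReal c)) := by ring
    _ ≤ E + (ENNReal.ofReal (σp - 1) * ENNReal.ofReal K + (ENNReal.ofReal δr +
          ENNReal.ofReal (σp - 1) * ENNReal.ofReal δr + ENNReal.ofReal σq + ENNReal.ofReal c)) := by
        gcongr
    _ = E + ENNReal.ofReal ((σp - 1) * K + σp * δr + σq + c) := by
        rw [← ENNReal.ofReal_mul (by linarith), ← ENNReal.ofReal_mul (by linarith),
          ← ENNReal.ofReal_add hδ (by nlinarith), ← ENNReal.ofReal_add (by nlinarith) hq,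
          ← ENNReal.ofReal_add (by nlinarith) hc, ← ENNReal.ofReal_add (by nlinarith) (by nlinarith)]
        congr 1
        ring

/-- **The transfer chain at fixed parameters** (see the module docstring for the notation).
[folklore] -/
theorem transfer_chain (hL : 0 < L) {v : ℝ → ℝ≥0∞} (hvm : Measurable v) {M : ℝ≥0∞}
    (hM : M ≠ ⊤) (hvM : ∀ r, v r ≤ M) {R₀ : ℝ} (hvR : ∀ r, R₀ < r → v r = 0)
    (hR : L / 2 + R₀ ≤ L) {c₀ : ℝ}
    (hprof : ∀ ℓ' L' : ℝ, 0 < ℓ' → 2 * ℓ' ≤ L' → ∃ q, IsCutoffProfile q ℓ' L' (c₀ / ℓ'))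
    {K h η μr δr T₀ σ D a₁ p₁ q₁ k₁ b₃ b₂ : ℝ}
    (hK : groundStateEnergy v N (L / 2) + 1 ≤ ENNReal.ofReal K) (hK0 : 0 ≤ K)
    (hh : 0 < h) (h8 : 8 * h < L) (hη : 0 < η) (hμ0 : 0 ≤ μr) (hμ : μr ≤ 1 / 2)
    (hδ0 : 0 ≤ δr) (hδ1 : δr ≤ 1) (hT₀ : 0 < T₀) (hKT : K ≤ μr * T₀)
    (hσ : σ = 1 + 8 * h / L) (hD : D = c₀ / (h / 2)) (ha₁ : a₁ = 1 + 2 * μr)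
    (hp₁ : p₁ = a₁ * (1 + η)) (hq₁ : q₁ = a₁ * (1 + η⁻¹) * D ^ 2 * (3 * μr))
    (hk₁ : k₁ = p₁ * K + q₁)
    (hb₃ : b₃ = 6 * N * (σ - 1) + 18 * N * (σ - 1) ^ 2 * (L / 2 + 4 * h) ^ 2 * k₁)
    (hb₂ : b₂ = 36 * N * h ^ 2 * K)
    {t : ℝ≥0∞} (ht : ENNReal.ofReal T₀ ≤ t) (Ψ : PeriodicTrialState N L)
    (hΨ : rampEnergy v (rimPot L) t Ψ ≤
      rampGroundStateEnergy v (rimPot L) t N L + ENNReal.ofReal δr) :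
    ∃ Φ : TrialState N (L / 2),
      energy v Φ ≤ groundStateEnergy v N (L / 2) +
        ENNReal.ofReal ((σ ^ 2 * p₁ - 1) * K + σ ^ 2 * p₁ * δr + σ ^ 2 * q₁ +
          2 * (N * N) * M.toReal * Real.sqrt b₃) ∧
      ∫⁻ X, (‖Φ.ψ X - (cellN N L).indicator Ψ.ψ X‖₊ : ℝ≥0∞) ^ 2 ≤
        ENNReal.ofReal ((Real.sqrt b₃ + Real.sqrt (4 * μr) + Real.sqrt b₂) ^ 2) := by
  -- ### energies along the ramp
  set ED : ℝ≥0∞ := groundStateEnergy v N (L / 2) with hED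
  set Et : ℝ≥0∞ := rampGroundStateEnergy v (rimPot L) t N L with hEt
  set Kt : ℝ≥0∞ := Et + ENNReal.ofReal δr with hKt
  have hEtD : Et ≤ ED := rampGroundStateEnergy_le_groundStateEnergy hvR hL (half_le_self hL.le) le_rfl hR t N
  have hδr1 : ENNReal.ofReal δr ≤ 1 := by rw [← ENNReal.ofReal_one]; exact ENNReal.ofReal_le_ofReal hδ1
  have hKtD : Kt ≤ ED + ENNReal.ofReal δr := add_le_add hEtD le_rfl
  have hKtK : Kt ≤ ENNReal.ofReal K := hKtD.trans ((add_le_add le_rfl hδr1).trans hK)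
  have hEDK : ED ≤ ENNReal.ofReal K := le_self_add.trans hK
  have he : periodicEnergy v Ψ ≤ Kt := (periodicEnergy_le_rampEnergy v _ t Ψ).trans hΨ
  have hKE : (∫⁻ X in cellN N L, kineticDensity Ψ.ψ X) ≤ ENNReal.ofReal K :=
    ((lintegral_mono fun X => le_self_add).trans he).trans hKtK
  -- ### the rim mass
  set m : ℝ≥0∞ := ∫⁻ X in cellN N L, (∑ j, rimPot L (X j)) * (‖Ψ.ψ X‖₊ : ℝ≥0∞) ^ 2 with hm_def
  have hmμ : m ≤ ENNReal.ofReal μr := by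
    refine (rimMass_le_ofReal hT₀ ht Ψ hΨ hKtK).trans (ENNReal.ofReal_le_ofReal ?_)
    rw [div_le_iff₀ hT₀]
    exact hKT
  have hμ1 : 0 < 1 - μr := by linarith only [hμ]
  have hm1 : m < 1 := by
    refine hmμ.trans_lt ?_
    rw [← ENNReal.ofReal_one]
    exact (ENNReal.ofReal_lt_ofReal_iff one_pos).2 (by linarith only [hμ])
  -- ### the cut-off state on the fattened cube
  obtain ⟨q, hq⟩ := hprof (h / 2) (L / 2 + 3 * h) (by positivity) (by linarith only [hL, hh])
  rw [← hD] at hq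
  obtain ⟨Φ₁, hE₁, hd₁⟩ := exists_cutoffTrialState hL hh h8 hq v Ψ hm1 hη
  -- its energy: `≤ ofReal p₁ * Kt + ofReal q₁ ≤ ofReal k₁`
  have ha₁0 : 0 < a₁ := by rw [ha₁]; positivity
  have ha₁1 : 1 ≤ a₁ := by rw [ha₁]; linarith only [hμ0]
  have ha₁inv : (1 - μr)⁻¹ ≤ a₁ := by
    rw [ha₁, inv_le_iff_one_le_mul₀ hμ1]
    nlinarith only [hμ0, hμ]
  have hp₁0 : 0 ≤ p₁ := by rw [hp₁]; positivity
  have hq₁0 : 0 ≤ q₁ := by rw [hq₁]; positivity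
  have hk₁0 : 0 ≤ k₁ := by rw [hk₁]; positivity
  have hinv : (1 - m)⁻¹ ≤ ENNReal.ofReal a₁ := by
    have h1 : ENNReal.ofReal (1 - μr) ≤ 1 - m := by
      rw [ENNReal.ofReal_sub 1 hμ0, ENNReal.ofReal_one]
      exact tsub_le_tsub_left hmμ 1
    calc (1 - m)⁻¹ ≤ (ENNReal.ofReal (1 - μr))⁻¹ := ENNReal.inv_le_inv.2 h1
      _ = ENNReal.ofReal (1 - μr)⁻¹ := by rw [ENNReal.ofReal_inv_of_pos hμ1]
      _ ≤ ENNReal.ofReal a₁ := ENNReal.ofReal_le_ofReal ha₁inv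
  have hE₁' : energy v Φ₁ ≤ ENNReal.ofReal p₁ * Kt + ENNReal.ofReal q₁ := by
    refine hE₁.trans ?_
    calc (1 - m)⁻¹ * ((1 + ENNReal.ofReal η) * periodicEnergy v Ψ +
          (1 + ENNReal.ofReal η⁻¹) * ENNReal.ofReal (D ^ 2) * (3 * m))
        ≤ ENNReal.ofReal a₁ * ((1 + ENNReal.ofReal η) * Kt +
          (1 + ENNReal.ofReal η⁻¹) * ENNReal.ofReal (D ^ 2) * (3 * ENNReal.ofReal μr)) := by
          gcongr
      _ = ENNReal.ofReal p₁ * Kt + ENNReal.ofReal q₁ := by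
          have e0 : (1 + ENNReal.ofReal η) = ENNReal.ofReal (1 + η) := by
            rw [ENNReal.ofReal_add zero_le_one hη.le, ENNReal.ofReal_one]
          have e0' : (1 + ENNReal.ofReal η⁻¹) = ENNReal.ofReal (1 + η⁻¹) := by
            rw [ENNReal.ofReal_add zero_le_one (inv_nonneg.2 hη.le), ENNReal.ofReal_one]
          have e3 : (3 : ℝ≥0∞) * ENNReal.ofReal μr = ENNReal.ofReal (3 * μr) := by
            rw [ENNReal.ofReal_mul (by norm_num), ENNReal.ofReal_ofNat]
          have e2 : ENNReal.ofReal (1 + η⁻¹) * ENNReal.ofReal (D ^ 2) * ENNReal.ofReal (3 * μr) =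
              ENNReal.ofReal ((1 + η⁻¹) * D ^ 2 * (3 * μr)) := by
            rw [← ENNReal.ofReal_mul (by positivity), ← ENNReal.ofReal_mul (by positivity)]
          rw [e0, e0', e3, e2, mul_add, ← mul_assoc, ← ENNReal.ofReal_mul ha₁0.le,
            ← ENNReal.ofReal_mul ha₁0.le, hp₁, hq₁,
            show a₁ * ((1 + η⁻¹) * D ^ 2 * (3 * μr)) = a₁ * (1 + η⁻¹) * D ^ 2 * (3 * μr) by ring]
  have hE₁k : energy v Φ₁ ≤ ENNReal.ofReal k₁ := by
    refine hE₁'.trans ?_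
    rw [hk₁, ENNReal.ofReal_add (by positivity) hq₁0, ENNReal.ofReal_mul hp₁0]
    gcongr
  have hKE₁ : (∫⁻ X, kineticDensity Φ₁.ψ X) ≤ ENNReal.ofReal k₁ :=
    (le_self_add.trans_eq (energy_eq_kinetic_add v Φ₁).symm).trans hE₁k
  -- ### the shrink
  set s : ℝ := (L / 2) / (L / 2 + 4 * h) with hs
  have hs0 : 0 < s := by rw [hs]; positivity
  have hs1 : s ≤ 1 := by rw [hs, div_le_one (by positivity)]; linarith only [hh]
  have hsl : s * (L / 2 + 4 * h) = L / 2 := by rw [hs]; field_simp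
  have hsσ : s⁻¹ = σ := by rw [hs, hσ, inv_div]; field_simp; ring
  have hσ1 : 0 ≤ σ - 1 := by rw [hσ, add_sub_cancel_left]; positivity
  have h1sσ : 1 - s ≤ σ - 1 := by
    rw [hs, hσ]
    have e : 1 - L / 2 / (L / 2 + 4 * h) = 4 * h / (L / 2 + 4 * h) := by field_simp; ring
    rw [e, add_sub_cancel_left, div_le_div_iff₀ (by positivity) hL]
    nlinarith only [hh, hL]
  set Φ₂ : TrialState N (s * (L / 2 + 4 * h)) := Φ₁.dilate hs0 with hΦ₂
  have h1s0 : 0 ≤ 1 - s := sub_nonneg.2 hs1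
  have hb₃0 : 0 ≤ b₃ := by rw [hb₃]; positivity
  have hb₂0 : 0 ≤ b₂ := by rw [hb₂]; positivity
  have hd₃ : ∫⁻ Y, (‖Φ₂.ψ Y - Φ₁.ψ Y‖₊ : ℝ≥0∞) ^ 2 ≤ ENNReal.ofReal b₃ := by
    calc ∫⁻ Y, (‖Φ₂.ψ Y - Φ₁.ψ Y‖₊ : ℝ≥0∞) ^ 2
        ≤ 2 * ENNReal.ofReal (3 * N * (1 - s)) +
          2 * ((3 * N : ℝ≥0∞) * ENNReal.ofReal (3 * (s⁻¹ - 1) ^ 2 * (L / 2 + 4 * h) ^ 2) *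
            ∫⁻ Y, kineticDensity Φ₁.ψ Y) := lintegral_dilate_sub_sq_le Φ₁ hs0 hs1
      _ ≤ 2 * ENNReal.ofReal (3 * N * (σ - 1)) +
          2 * ((3 * N : ℝ≥0∞) * ENNReal.ofReal (3 * (σ - 1) ^ 2 * (L / 2 + 4 * h) ^ 2) *
            ENNReal.ofReal k₁) := by rw [hsσ]; gcongr
      _ = ENNReal.ofReal b₃ := by
          have e3 : (3 * N : ℝ≥0∞) = ENNReal.ofReal (3 * N) := by
            rw [ENNReal.ofReal_mul (by norm_num), ENNReal.ofReal_ofNat, ENNReal.ofReal_natCast]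
          have e2 : ∀ x : ℝ, 0 ≤ x → (2 : ℝ≥0∞) * ENNReal.ofReal x = ENNReal.ofReal (2 * x) :=
            fun x _ => by rw [ENNReal.ofReal_mul (by norm_num), ENNReal.ofReal_ofNat]
          rw [e3, ← ENNReal.ofReal_mul (by positivity), ← ENNReal.ofReal_mul (by positivity),
            e2 _ (by positivity), e2 _ (by positivity),
            ← ENNReal.ofReal_add (by positivity) (by positivity), hb₃]
          congr 1
          ring
  have hE₂ : energy v Φ₂ ≤ ED + ENNReal.ofReal ((σ ^ 2 * p₁ - 1) * K + σ ^ 2 * p₁ * δr +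
      σ ^ 2 * q₁ + 2 * (N * N) * M.toReal * Real.sqrt b₃) := by
    have h1 := energy_dilate_le hvm hM hvM Φ₁ hs0 hs1
    have hsq : (∫⁻ Y, (‖Φ₂.ψ Y - Φ₁.ψ Y‖₊ : ℝ≥0∞) ^ 2) ^ (1 / 2 : ℝ) ≤
        ENNReal.ofReal (Real.sqrt b₃) :=
      l2dist_rpow_half_le (Real.sqrt_nonneg _) (by rwa [Real.sq_sqrt hb₃0])
    have hs2 : ENNReal.ofReal (s ^ 2)⁻¹ = ENNReal.ofReal (σ ^ 2) := by rw [← inv_pow, hsσ]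
    have hθ : 1 ≤ σ ^ 2 * p₁ := by
      have h1s : 1 ≤ σ := by linarith only [hσ1]
      have hp : 1 ≤ p₁ := by
        rw [hp₁]
        exact one_le_mul_of_one_le_of_one_le ha₁1 (by linarith only [hη])
      exact one_le_mul_of_one_le_of_one_le (one_le_pow₀ h1s) hp
    have hM' : M = ENNReal.ofReal M.toReal := (ENNReal.ofReal_toReal hM).symm
    have eI : (N * N : ℝ≥0∞) * M * (2 * ENNReal.ofReal (Real.sqrt b₃)) =
        ENNReal.ofReal (2 * (N * N) * M.toReal * Real.sqrt b₃) := by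
      conv_lhs => rw [hM', ← ENNReal.ofReal_natCast, ← ENNReal.ofReal_mul (Nat.cast_nonneg _),
        ← ENNReal.ofReal_mul (by positivity), ← ENNReal.ofReal_ofNat 2,
        ← ENNReal.ofReal_mul (by norm_num), ← ENNReal.ofReal_mul (by positivity)]
      congr 1
      ring
    calc energy v Φ₂ ≤ ENNReal.ofReal (s ^ 2)⁻¹ * energy v Φ₁ +
          (N * N : ℝ≥0∞) * M * (2 * (∫⁻ Y, (‖Φ₂.ψ Y - Φ₁.ψ Y‖₊ : ℝ≥0∞) ^ 2) ^ (1 / 2 : ℝ)) := h1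
      _ ≤ ENNReal.ofReal (σ ^ 2) * (ENNReal.ofReal p₁ * (ED + ENNReal.ofReal δr) + ENNReal.ofReal q₁) +
          (N * N : ℝ≥0∞) * M * (2 * ENNReal.ofReal (Real.sqrt b₃)) := by
          rw [hs2]
          gcongr
          exact hE₁'.trans (by gcongr)
      _ = ENNReal.ofReal (σ ^ 2 * p₁) * (ED + ENNReal.ofReal δr) + ENNReal.ofReal (σ ^ 2 * q₁) +
          ENNReal.ofReal (2 * (N * N) * M.toReal * Real.sqrt b₃) := by
          rw [eI, mul_add, ← mul_assoc, ← ENNReal.ofReal_mul (sq_nonneg _),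
            ← ENNReal.ofReal_mul (sq_nonneg _)]
      _ ≤ _ := ofReal_mul_add_le_add_ofReal hEDK hK0 hθ hδ0 (by positivity) (by positivity)
  -- ### the distance to the cell cut-off
  set U : Config N := fun _ => (WithLp.toLp 2 fun _ : Fin 3 => -(2 * h) : Space) with hU
  have hΨm : Measurable Ψ.ψ := Ψ.contDiff.continuous.measurable
  have hGUm : Measurable ((cellN N L).indicator fun X => Ψ.ψ (X + U)) :=
    (hΨm.comp (measurable_id.add_const U)).indicator (measurableSet_cellN N L)
  have hGm : Measurable ((cellN N L).indicator Ψ.ψ) := hΨm.indicator (measurableSet_cellN N L)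
  have hd₂ : ∫⁻ X, (‖(cellN N L).indicator (fun X => Ψ.ψ (X + U)) X -
      (cellN N L).indicator Ψ.ψ X‖₊ : ℝ≥0∞) ^ 2 ≤ ENNReal.ofReal b₂ := by
    have e : (fun X => (‖(cellN N L).indicator (fun X => Ψ.ψ (X + U)) X -
        (cellN N L).indicator Ψ.ψ X‖₊ : ℝ≥0∞) ^ 2) =
        (cellN N L).indicator fun X => (‖Ψ.ψ (X + U) - Ψ.ψ X‖₊ : ℝ≥0∞) ^ 2 := by
      funext X
      by_cases hX : X ∈ cellN N L
      · simp [indicator_of_mem hX]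
      · simp [indicator_of_notMem hX]
    rw [e, lintegral_indicator (measurableSet_cellN N L)]
    refine (lintegral_cellN_sub_translate_sq_le hL Ψ U).trans ?_
    calc (3 * N : ℝ≥0∞) * ENNReal.ofReal (‖U‖ ^ 2) * ∫⁻ X in cellN N L, kineticDensity Ψ.ψ X
        ≤ (3 * N : ℝ≥0∞) * ENNReal.ofReal (12 * h ^ 2) * ENNReal.ofReal K := by
          gcongr
          exact norm_shift_sq_le N h
      _ = ENNReal.ofReal b₂ := by
          rw [hb₂, natCast_eq_ofReal, show (3 : ℝ≥0∞) = ENNReal.ofReal 3 by norm_num,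
            ← ENNReal.ofReal_mul (by norm_num), ← ENNReal.ofReal_mul (by positivity),
            ← ENNReal.ofReal_mul (by positivity)]
          congr 1; ring
  have hd₁' : ∫⁻ X, (‖Φ₁.ψ X - (cellN N L).indicator (fun X => Ψ.ψ (X + U)) X‖₊ : ℝ≥0∞) ^ 2 ≤
      ENNReal.ofReal (4 * μr) := by
    refine hd₁.trans ?_
    rw [ENNReal.ofReal_mul (by norm_num : (0 : ℝ) ≤ 4), ENNReal.ofReal_ofNat]
    gcongr
  have hdist : (∫⁻ X, (‖Φ₂.ψ X - (cellN N L).indicator Ψ.ψ X‖₊ : ℝ≥0∞) ^ 2) ^ (1 / 2 : ℝ) ≤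
      ENNReal.ofReal (Real.sqrt b₃ + Real.sqrt (4 * μr) + Real.sqrt b₂) := by
    have hΦ₂m : Measurable Φ₂.ψ := Φ₂.contDiff.continuous.measurable
    have hΦ₁m : Measurable Φ₁.ψ := Φ₁.contDiff.continuous.measurable
    have t1 := l2dist_triangle hΦ₂m hΦ₁m hGm
    have t2 := l2dist_triangle hΦ₁m hGUm hGm
    have e₃ : (∫⁻ X, (‖Φ₂.ψ X - Φ₁.ψ X‖₊ : ℝ≥0∞) ^ 2) ^ (1 / 2 : ℝ) ≤ ENNReal.ofReal (Real.sqrt b₃) :=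
      l2dist_rpow_half_le (Real.sqrt_nonneg _) (by rwa [Real.sq_sqrt hb₃0])
    have e₁ : (∫⁻ X, (‖Φ₁.ψ X - (cellN N L).indicator (fun X => Ψ.ψ (X + U)) X‖₊ : ℝ≥0∞) ^ 2) ^
        (1 / 2 : ℝ) ≤ ENNReal.ofReal (Real.sqrt (4 * μr)) :=
      l2dist_rpow_half_le (Real.sqrt_nonneg _) (by rwa [Real.sq_sqrt (by positivity)])
    have e₂ : (∫⁻ X, (‖(cellN N L).indicator (fun X => Ψ.ψ (X + U)) X -
        (cellN N L).indicator Ψ.ψ X‖₊ : ℝ≥0∞) ^ 2) ^ (1 / 2 : ℝ) ≤ ENNReal.ofReal (Real.sqrt b₂) :=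
      l2dist_rpow_half_le (Real.sqrt_nonneg _) (by rwa [Real.sq_sqrt hb₂0])
    calc _ ≤ _ := t1
      _ ≤ ENNReal.ofReal (Real.sqrt b₃) + (ENNReal.ofReal (Real.sqrt (4 * μr)) +
          ENNReal.ofReal (Real.sqrt b₂)) := add_le_add e₃ (t2.trans (add_le_add e₁ e₂))
      _ = _ := by
          rw [← ENNReal.ofReal_add (Real.sqrt_nonneg _) (Real.sqrt_nonneg _),
            ← ENNReal.ofReal_add (Real.sqrt_nonneg _) (by positivity), add_assoc]
  -- ### transport to side `L/2`
  refine ⟨hsl ▸ Φ₂, ?_, ?_⟩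
  · rw [energy_eqRec_trialState]
    exact hE₂
  · rw [eqRec_trialState_ψ]
    have hsq : ∀ x : ℝ≥0∞, (x ^ (1 / 2 : ℝ)) ^ 2 = x := fun x => by
      rw [← ENNReal.rpow_two, ← ENNReal.rpow_mul]
      norm_num
    calc ∫⁻ X, (‖Φ₂.ψ X - (cellN N L).indicator Ψ.ψ X‖₊ : ℝ≥0∞) ^ 2
        = ((∫⁻ X, (‖Φ₂.ψ X - (cellN N L).indicator Ψ.ψ X‖₊ : ℝ≥0∞) ^ 2) ^ (1 / 2 : ℝ)) ^ 2 :=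
          (hsq _).symm
      _ ≤ (ENNReal.ofReal (Real.sqrt b₃ + Real.sqrt (4 * μr) + Real.sqrt b₂)) ^ 2 := by gcongr
      _ = _ := by rw [← ENNReal.ofReal_pow (by positivity)]

/-- **Anchor of this block** (quantified form of `transfer_chain`). [folklore] -/
theorem stub_hardWallLimit_chain : ∀ {N : ℕ} {L : ℝ}, 0 < L → ∀ {v : ℝ → ℝ≥0∞}, Measurable v → ∀ {M : ℝ≥0∞}, M ≠ ⊤ → (∀ r, v r ≤ M) → ∀ {R₀ : ℝ}, (∀ r, R₀ < r → v r = 0) → L / 2 + R₀ ≤ L → ∀ {c₀ : ℝ}, (∀ ℓ' L' : ℝ, 0 < ℓ' → 2 * ℓ' ≤ L' → ∃ q, IsCutoffProfile q ℓ' L' (c₀ / ℓ')) → ∀ {K h η μr δr T₀ σ D a₁ p₁ q₁ k₁ b₃ b₂ : ℝ}, groundStateEnergy v N (L / 2) + 1 ≤ ENNReal.ofReal K → 0 ≤ K → 0 < h → 8 * h < L → 0 < η → 0 ≤ μr → μr ≤ 1 / 2 → 0 ≤ δr → δr ≤ 1 → 0 < T₀ → K ≤ μr * T₀ → σ = 1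 + 8 * h / L → D = c₀ / (h / 2) → a₁ = 1 + 2 * μr → p₁ = a₁ * (1 + η) → q₁ = a₁ * (1 + η⁻¹) * D ^ 2 * (3 * μr) → k₁ = p₁ * K + q₁ → b₃ = 6 * N * (σ - 1) + 18 * N * (σ - 1) ^ 2 * (L / 2 + 4 * h) ^ 2 * k₁ → b₂ = 36 * N * h ^ 2 * K → ∀ {t : ℝ≥0∞}, ENNReal.ofReal T₀ ≤ t → ∀ Ψ : PeriodicTrialState N L, rampEnergy v (rimPot L) t Ψ ≤ rampGroundStateEnergy v (rimPot L) t N L + ENNReal.ofReal δr → ∃ Φ : TrialState N (L / 2), energy v Φ ≤ groundStateEnergy v N (L / 2) + ENNReal.ofReal ((σ ^ 2 * p₁ - 1) * K + σ ^ 2 * p₁ * δr + σ ^ 2 * q₁ + 2 * (N * N) * M.toReal * Real.sqrt b₃) ∧ ∫⁻ X : Config N, (‖Φ.ψ X - (cellN N L).indicator Ψ.ψ X‖₊ : ℝ≥0∞) ^ 2 ≤ ENNReal.ofReal ((Real.sqrt b₃ + Real.sqrt (4 * μr) + Real.sqrt b₂) ^ 2) :=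
  fun hL _ hvm _ hM hvM _ hvR hR _ hprof _ _ _ _ _ _ _ _ _ _ _ _ _ _ hK hK0 hh h8 hη hμ0 hμ hδ0 hδ1 hT₀ hKT hσ hD ha₁ hp₁ hq₁ hk₁ hb₃ hb₂ _ ht Ψ hΨ =>
    transfer_chain hL hvm hM hvM hvR hR hprof hK hK0 hh h8 hη hμ0 hμ hδ0 hδ1 hT₀ hKT hσ hD ha₁ hp₁ hq₁ hk₁ hb₃ hb₂ ht Ψ hΨ

end Summit.AtomisticToContinuum.BoseEinsteinCondensation.RimSqueeze

end
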